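/-
Copyright (c) 2026 the pub-hodgecm-mathlib formalisation cell (harness21).  Prover seat hodgecm-mathlib-LH4-p08 (g8), req620 Track A «(D-RAM) FOUR-FRAME» squad, helper lane
on h413 = stmt-HodgeConjecture-24833 (count-neutral).  STAGE-1b, row (2) cone road (dealer∕pen LH4-plan (g13) WORD #65 (2); LH4-p07 (g9) «the cut twins are then one rw each»):
(T5s♭-Unr) × (R2) «THE TYPE-U FLIPPED-CLASS CENSUS SUM MINUS THE CUT TOP BAND».  2026-09-04.
-/
import Summits.HodgeConjecture.HodgeConjecture.Theorems.F0P3cDyRamToricCensusSumUnrV5Cutoff   -- ★ p859859 (this seat): `cutP_eval`, `cutM_eval` (parity-free cut bands), `toricCensusSum_unr_v5_cutoff`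
import Summits.HodgeConjecture.HodgeConjecture.Theorems.F0P3cDyRamToricCensusSumUnrV5Flip     -- ★ p859860 (this seat): `toricCensusSum_unr_v5_flip`
import Summits.HodgeConjecture.HodgeConjecture.Theorems.F0P3cDyRamToricCensusSumRamKCutOffset -- ★ p859832 (LH4-p07 (g9)): `cutSum_eq_of_agree_below_alive` (type-free; reused, not restated)
import HarnessLib

/-!
# Crux `H413`, line LH4 «(D-RAM) FOUR-FRAME» — STAGE-1b, row (2): (T5s♭-Unr) × (T5-P-coneΔ-R2) «THE TYPE-U FLIPPED-CLASS TORIC CENSUS SUM (SHEET v5) MINUS THE CUT TOP BAND»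

Cell `hodgecm-mathlib` (D-0151), FLOOR 0, crux item H413 = `stmt-HodgeConjecture-24833`, route of record `HCCMUnconditional`; squad F0∕P3c∕LH4 (req618∕req620); helper lane
`--supports stmt-HodgeConjecture-24833 --as helper` (count-neutral).  THEOREMS ONLY (no `def`, no instance, no notation, no `sorry`; default heartbeats).  Pure finite-sum
bookkeeping over `ℚ` on the ABSTRACT tables of ★ p857461 `toricCensusSum_unr_v5`.

WHAT.  The ODD-`a′` level pieces of type U sit in the flipped token class (`jl₁` odd, `m₁ ≢ d` on the ε = 1 branch; ★ `toricCensusSum_unr_v5_flip`), and near `1` their cone cells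
are cut along `j + a ≤ C`, `C = m₁ + jl₁ − (b′ − 2a′)` (★ p859713, regime (R2)).  The cut bands ★ `cutP_eval` ∕ ★ `cutM_eval` are parity-free, so the cut twin on the flipped class
is ONE composition: §1 **`toricCensusSum_unr_v5_flip_cutoff`** — ★ `toricCensusSum_unr_v5_flip`'s binders VERBATIM + `(C : ℕ) (hC : jl ≤ C)` (★ p859753 layout and
summand), value = ★ flipped value `q^m·(1 + (q+1)[⌊jl∕2⌋ + d%2]_q − 2[d − 1 + d%2]_q)` − the SAME two bands as ★ p859859 `toricCensusSum_unr_v5_cutoff` (column window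
`a ∈ [a₀, a⋆]`, `a₀ = (C + m − jl)∕2 + 1`, `a⋆ = (2m + 1 − d)∕2`; on the ε = 1 branch only the `+` band fires — `jl − m − d` is even there too —, on ε = −1 only the `−` band);
§2 **`toricCensusSum_unr_v5_flip_cutoff_offset`** — the same with the top rows' alive conjunct SHIFTED to `2j + d ≤ 2jl + 1 + e` (`hvTopPE∕ME`, any `e : ℕ`; the scaled
multiplier's cells are alive up to the UNSCALED conductor, LH4-p07 (g9) ★ p859832's point) under `C + d ≤ m + jl + 1`: the offset band is cut, so the value is §1's VERBATIM
(re-cut tables + ★ `cutSum_eq_of_agree_below_alive`, imported from ★ p859832).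
HONEST LABEL.  Count-neutral (`--supports`); nothing printed is asserted; no census LAW is stated (abstract tables; the weld at `μ₁` and its alive offset are the (LAW) ∕ (D3♯)
organs'); pays no registered stub and touches no `Lines/` module; the seven tier-0 ED. 5 sorries stay OPEN; `HC_CM` is proved only modulo the 7 printed citations (2 remaining named
inputs: hLiu418 = `stmt-HodgeConjecture-24832`, h413 = `stmt-HodgeConjecture-24833`) until rung 0 closes.

## References
* [Kottwitz1986BaseChangeUnits] R. E. Kottwitz, *Base change for unit elements of Hecke algebras*, Compositio Math. 60 (1986), §1 pp. 240–241.
* [Rogawski1990] J. D. Rogawski, *Automorphic Representations of Unitary Groups in Three Variables*, Ann. of Math. Stud. 123 (1990), §4.9 Prop. 4.9.1 (b) p. 55, Lemma 4.9.3 p. 56.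
* [Flicker1998UnitaryFL] Y. Z. Flicker, *Elementary proof of the fundamental lemma for a unitary group*, Canad. J. Math. 50 (1998), Prop. 7 p. 84 (the level tables).
-/

set_option autoImplicit false

namespace Summit.HodgeConjecture.HodgeConjecture.Cruxes.H413.F0P3cDyRamToricCensusSumUnrV5FlipCutoff

open Finset
open Summit.HodgeConjecture.HodgeConjecture.Cruxes.H413.F0P3cDyRamToricCensusSumUnrV5Cutoff (cutP_eval cutM_eval)
open Summit.HodgeConjecture.HodgeConjecture.Cruxes.H413.F0P3cDyRamToricCensusSumUnrV5Flip (toricCensusSum_unr_v5_flip)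
open Summit.HodgeConjecture.HodgeConjecture.Cruxes.H413.F0P3cDyRamToricCensusSumRamKCutOffset (cutSum_eq_of_agree_below_alive)

/-! ## §1 The flipped-class census sum minus the cut top band -/

/-- **(T5s♭-Unr) × (R2) — THE TYPE-U FLIPPED-CLASS TORIC CENSUS SUM MINUS THE CUT TOP BAND.**  ★ `toricCensusSum_unr_v5_flip`'s binders VERBATIM (sheet-v5 tables; `jl` odd;
`{ε = +1, m ≢ d (2), 1 ≤ m ≤ jl − d} ∪ {ε = −1, m = jl − d + 1}`; `S − 1 ≤ m`) + a cutoff `C ≥ jl`: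
`ε·Σ_{j ≤ jl} Σ_a q^a·(if j + a ≤ C then vP j a − vM j a else 0) = q^m·(1 + (q+1)[⌊jl∕2⌋ + d%2]_q − 2[d − 1 + d%2]_q) − [m + d ≤ jl, jl−m−d even]·(q+1)q^{a₀ + d + (jl−m−d)∕2 +
⌊m∕2⌋ − 1}·[a⋆ + 1 − a₀]_q − [jl + 1 = d + m]·(q+1)q^{a₀ + d + m − ⌊m∕2⌋ − 2}·[a⋆ + 1 − a₀]_q`, `a₀ = (C + m − jl)∕2 + 1`, `a⋆ = (2m + 1 − d)∕2` — ★ flipped value minus the two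
parity-free bands ★ `cutP_eval` ∕ ★ `cutM_eval`. [cite: Kottwitz1986BaseChangeUnits, §1 pp. 240–241] [cite: Rogawski1990, §4.9 Prop. 4.9.1 (b) p. 55, Lemma 4.9.3 p. 56]
[cite: Flicker1998UnitaryFL, Prop. 7 p. 84] -/
theorem toricCensusSum_unr_v5_flip_cutoff (q : ℕ) {d jl m : ℕ} (ε : ℚ) (hq : 2 ≤ q) (hd : 2 ≤ d) (hjl : jl % 2 = 1) (hmS : d - d % 2 ≤ m + 1)
    (hreal : (ε = 1 ∧ m % 2 ≠ d % 2 ∧ 1 ≤ m ∧ m + d ≤ jl) ∨ (ε = -1 ∧ m = jl - d + 1 ∧ d ≤ jl))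
    (nP nM vP vM : ℕ → ℕ → ℚ)
    (hnP : ∀ j a, 1 ≤ a → nP j a = if a + d ≤ j ∧ (j - a - d) % 2 = 0 then ((q : ℚ) ^ 2 - 1) * (q : ℚ) ^ (j - 2 - (j - a - d) / 2) else 0)
    (hnP0 : ∀ j, nP j 0 = if (j + d) % 2 = 0 then (if d ≤ j then ((q : ℚ) + 1) * (q : ℚ) ^ ((j + d) / 2 - 1) else (if j = 0 then 1 else ((q : ℚ) + 1) * (q : ℚ) ^ (j - 1))) else 0)
    (hnM : ∀ j a, nM j a = if (d ≤ j + 1 ∧ a + d = j + 1) ∨ (j + 1 < d ∧ a = 0 ∧ (j + d) % 2 = 1) then (if j = 0 then 1 else ((q : ℚ) + 1) * (q : ℚ) ^ (j - 1)) else 0)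
    (hv0 : ∀ j, vP j 0 = nP j 0 ∧ vM j 0 = nM j 0)
    (hvOff : ∀ j a, 1 ≤ a → j + m ≠ jl + a →
      (vP j a = if 2 * a ≤ m ∧ (j + a ≤ m ∨ j + a ≤ jl) then nP j a else 0) ∧ (vM j a = if 2 * a ≤ m ∧ (j + a ≤ m ∨ j + a ≤ jl) then nM j a else 0))
    (hvLow : ∀ j a, 1 ≤ a → j + m = jl + a → 2 * a ≤ m → vP j a = nP j a ∧ vM j a = nM j a)
    (hvTopP : ∀ j a, 1 ≤ a → j + m = jl + a → m < 2 * a →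
      vP j a = if (d + m ≤ jl ∧ (jl - d - m) % 2 = 0) ∧ 2 * j + d ≤ 2 * jl + 1 then nP j a / (((q : ℚ) - 1) * (q : ℚ) ^ ((2 * a - m + 1) / 2 - 1)) else 0)
    (hvTopM : ∀ j a, 1 ≤ a → j + m = jl + a → m < 2 * a →
      vM j a = if jl + 1 = d + m ∧ 2 * j + d ≤ 2 * jl + 1 then nM j a / (q : ℚ) ^ ((2 * a - m) / 2) else 0)
    (C : ℕ) (hC : jl ≤ C) :
    ε * ∑ j ∈ range (jl + 1), ∑ a ∈ range (jl + 2), (q : ℚ) ^ a * (if j + a ≤ C then vP j a - vM j a else 0) =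
      (q : ℚ) ^ m * ((1 + ((q : ℚ) + 1) * ∑ i ∈ range (jl / 2 + d % 2), (q : ℚ) ^ i) - 2 * ∑ i ∈ range (d - 1 + d % 2), (q : ℚ) ^ i)
      - (if m + d ≤ jl ∧ (jl - m - d) % 2 = 0 then
          ((q : ℚ) + 1) * (q : ℚ) ^ (((C + m - jl) / 2 + 1) + d + (jl - m - d) / 2 + m / 2 - 1) *
            ∑ i ∈ range (((2 * m + 1 - d) / 2 + 1) - ((C + m - jl) / 2 + 1)), (q : ℚ) ^ i
        else 0)
      - (if jl + 1 = d + m then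
          ((q : ℚ) + 1) * (q : ℚ) ^ (((C + m - jl) / 2 + 1) + d + m - m / 2 - 2) *
            ∑ i ∈ range (((2 * m + 1 - d) / 2 + 1) - ((C + m - jl) / 2 + 1)), (q : ℚ) ^ i
        else 0) := by
  have hx0 : (q : ℚ) ≠ 0 := Nat.cast_ne_zero.2 (by omega)
  have hx1 : (q : ℚ) ≠ 1 := by exact_mod_cast (show q ≠ 1 by omega)
  have hm : m ≤ jl := by
    rcases hreal with ⟨-, -, -, h⟩ | ⟨-, h, h'⟩ <;> omega
  -- ★ T5s on the whole table
  have hT := toricCensusSum_unr_v5_flip q ε hq hd hjl hmS hreal nP nM vP vM hnP hnP0 hnM hv0 hvOff hvLow hvTopP hvTopM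
  -- split the whole table along the cutoff
  have hsplit : ∑ j ∈ range (jl + 1), ∑ a ∈ range (jl + 2), (q : ℚ) ^ a * (vP j a - vM j a) =
      ∑ j ∈ range (jl + 1), ∑ a ∈ range (jl + 2), (q : ℚ) ^ a * (if j + a ≤ C then vP j a - vM j a else 0) +
        ∑ j ∈ range (jl + 1), ∑ a ∈ range (jl + 2), (if j + a ≤ C then 0 else (q : ℚ) ^ a * (vP j a - vM j a)) := by
    rw [← Finset.sum_add_distrib]
    refine Finset.sum_congr rfl fun j _ => ?_
    rw [← Finset.sum_add_distrib]
    refine Finset.sum_congr rfl fun a _ => ?_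
    by_cases h : j + a ≤ C
    · rw [if_pos h, if_pos h, add_zero]
    · rw [if_neg h, if_neg h, mul_zero, zero_add]
  -- the cut part is `cutP − cutM`
  have hP := cutP_eval (q : ℚ) hx0 hx1 hd hm hC nP vP hnP (fun j a ha hne => (hvOff j a ha hne).1) hvTopP
  have hM := cutM_eval (q : ℚ) hx0 hd hm hC nM vM hnM (fun j a ha hne => (hvOff j a ha hne).2) hvTopM
  have hrem : ∑ j ∈ range (jl + 1), ∑ a ∈ range (jl + 2), (if j + a ≤ C then 0 else (q : ℚ) ^ a * (vP j a - vM j a)) =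
      ∑ j ∈ range (jl + 1), ∑ a ∈ range (jl + 2), (if j + a ≤ C then 0 else (q : ℚ) ^ a * vP j a) -
        ∑ j ∈ range (jl + 1), ∑ a ∈ range (jl + 2), (if j + a ≤ C then 0 else (q : ℚ) ^ a * vM j a) := by
    rw [← Finset.sum_sub_distrib]
    refine Finset.sum_congr rfl fun j _ => ?_
    rw [← Finset.sum_sub_distrib]
    refine Finset.sum_congr rfl fun a _ => ?_
    split_ifs <;> ring
  rw [hsplit, hrem, hP, hM] at hT
  -- on the realizable set exactly one band fires
  rcases hreal with ⟨hε, -, -, hmd⟩ | ⟨hε, hmeq, -⟩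
  · subst hε
    rw [if_neg (show ¬ (jl + 1 = d + m) by omega)] at hT ⊢
    linear_combination hT
  · subst hε
    rw [if_neg (show ¬ (m + d ≤ jl ∧ (jl - m - d) % 2 = 0) from fun h => by omega)] at hT ⊢
    linear_combination hT

/-! ## §2 The same with an alive offset (the scaled multiplier's top rows are alive up to the unscaled conductor) -/

/-- **(T5s♭-Unr) × (R2) WITH AN ALIVE OFFSET.**  `toricCensusSum_unr_v5_flip_cutoff`'s binders with the top rows' alive condition SHIFTED to `2j + d ≤ 2jl + 1 + e`
(`hvTopPE ∕ hvTopME`, any `e : ℕ`; the cells of a scaled multiplier are alive up to the unscaled conductor), a cutoff `C` with `jl ≤ C` and `C + d ≤ m + jl + 1` (the offset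
band is cut): the cut sum has `toricCensusSum_unr_v5_flip_cutoff`'s value VERBATIM (★ flipped value minus the two cut top bands); re-cut tables + ★
`cutSum_eq_of_agree_below_alive` (LH4-p07 (g9) ★ p859832, imported). [cite: Kottwitz1986BaseChangeUnits, §1 pp. 240–241]
[cite: Rogawski1990, §4.9 Prop. 4.9.1 (b) p. 55, Lemma 4.9.3 p. 56] [cite: Flicker1998UnitaryFL, Prop. 7 p. 84] -/
theorem toricCensusSum_unr_v5_flip_cutoff_offset (q : ℕ) {d jl m : ℕ} (ε : ℚ) (hq : 2 ≤ q) (hd : 2 ≤ d) (hjl : jl % 2 = 1) (hmS : d - d % 2 ≤ m + 1)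
    (hreal : (ε = 1 ∧ m % 2 ≠ d % 2 ∧ 1 ≤ m ∧ m + d ≤ jl) ∨ (ε = -1 ∧ m = jl - d + 1 ∧ d ≤ jl))
    (nP nM vP vM : ℕ → ℕ → ℚ)
    (hnP : ∀ j a, 1 ≤ a → nP j a = if a + d ≤ j ∧ (j - a - d) % 2 = 0 then ((q : ℚ) ^ 2 - 1) * (q : ℚ) ^ (j - 2 - (j - a - d) / 2) else 0)
    (hnP0 : ∀ j, nP j 0 = if (j + d) % 2 = 0 then (if d ≤ j then ((q : ℚ) + 1) * (q : ℚ) ^ ((j + d) / 2 - 1) else (if j = 0 then 1 else ((q : ℚ) + 1) * (q : ℚ) ^ (j - 1))) else 0)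
    (hnM : ∀ j a, nM j a = if (d ≤ j + 1 ∧ a + d = j + 1) ∨ (j + 1 < d ∧ a = 0 ∧ (j + d) % 2 = 1) then (if j = 0 then 1 else ((q : ℚ) + 1) * (q : ℚ) ^ (j - 1)) else 0)
    (hv0 : ∀ j, vP j 0 = nP j 0 ∧ vM j 0 = nM j 0)
    (hvOff : ∀ j a, 1 ≤ a → j + m ≠ jl + a →
      (vP j a = if 2 * a ≤ m ∧ (j + a ≤ m ∨ j + a ≤ jl) then nP j a else 0) ∧ (vM j a = if 2 * a ≤ m ∧ (j + a ≤ m ∨ j + a ≤ jl) then nM j a else 0))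
    (hvLow : ∀ j a, 1 ≤ a → j + m = jl + a → 2 * a ≤ m → vP j a = nP j a ∧ vM j a = nM j a)
    (e : ℕ)
    (hvTopPE : ∀ j a, 1 ≤ a → j + m = jl + a → m < 2 * a →
      vP j a = if (d + m ≤ jl ∧ (jl - d - m) % 2 = 0) ∧ 2 * j + d ≤ 2 * jl + 1 + e then nP j a / (((q : ℚ) - 1) * (q : ℚ) ^ ((2 * a - m + 1) / 2 - 1)) else 0)
    (hvTopME : ∀ j a, 1 ≤ a → j + m = jl + a → m < 2 * a →
      vM j a = if jl + 1 = d + m ∧ 2 * j + d ≤ 2 * jl + 1 + e then nM j a / (q : ℚ) ^ ((2 * a - m) / 2) else 0)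
    (C : ℕ) (hC : jl ≤ C) (hCe : C + d ≤ m + jl + 1) :
    ε * ∑ j ∈ range (jl + 1), ∑ a ∈ range (jl + 2), (q : ℚ) ^ a * (if j + a ≤ C then vP j a - vM j a else 0) =
      (q : ℚ) ^ m * ((1 + ((q : ℚ) + 1) * ∑ i ∈ range (jl / 2 + d % 2), (q : ℚ) ^ i) - 2 * ∑ i ∈ range (d - 1 + d % 2), (q : ℚ) ^ i)
      - (if m + d ≤ jl ∧ (jl - m - d) % 2 = 0 then
          ((q : ℚ) + 1) * (q : ℚ) ^ (((C + m - jl) / 2 + 1) + d + (jl - m - d) / 2 + m / 2 - 1) *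
            ∑ i ∈ range (((2 * m + 1 - d) / 2 + 1) - ((C + m - jl) / 2 + 1)), (q : ℚ) ^ i
        else 0)
      - (if jl + 1 = d + m then
          ((q : ℚ) + 1) * (q : ℚ) ^ (((C + m - jl) / 2 + 1) + d + m - m / 2 - 2) *
            ∑ i ∈ range (((2 * m + 1 - d) / 2 + 1) - ((C + m - jl) / 2 + 1)), (q : ℚ) ^ i
        else 0) := by
  classical
  -- the standard-alive tables: the given ones, re-cut at `2j + d ≤ 2jl + 1` on the top diagonal
  set wP : ℕ → ℕ → ℚ := fun j a => if 1 ≤ a ∧ j + m = jl + a ∧ m < 2 * a then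
      (if (d + m ≤ jl ∧ (jl - d - m) % 2 = 0) ∧ 2 * j + d ≤ 2 * jl + 1 then nP j a / (((q : ℚ) - 1) * (q : ℚ) ^ ((2 * a - m + 1) / 2 - 1)) else 0)
    else vP j a with hwP
  set wM : ℕ → ℕ → ℚ := fun j a => if 1 ≤ a ∧ j + m = jl + a ∧ m < 2 * a then
      (if jl + 1 = d + m ∧ 2 * j + d ≤ 2 * jl + 1 then nM j a / (q : ℚ) ^ ((2 * a - m) / 2) else 0)
    else vM j a with hwM
  have hw0 : ∀ j, wP j 0 = nP j 0 ∧ wM j 0 = nM j 0 := fun j => by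
    obtain ⟨h1, h2⟩ := hv0 j
    rw [hwP, hwM]; dsimp only
    rw [if_neg (show ¬ (1 ≤ 0 ∧ j + m = jl + 0 ∧ m < 2 * 0) from fun h => by omega),
      if_neg (show ¬ (1 ≤ 0 ∧ j + m = jl + 0 ∧ m < 2 * 0) from fun h => by omega), h1, h2]
    exact ⟨rfl, rfl⟩
  have hwOff : ∀ j a, 1 ≤ a → j + m ≠ jl + a →
      (wP j a = if 2 * a ≤ m ∧ (j + a ≤ m ∨ j + a ≤ jl) then nP j a else 0) ∧ (wM j a = if 2 * a ≤ m ∧ (j + a ≤ m ∨ j + a ≤ jl) then nM j a else 0) :=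
    fun j a ha hoff => by
    obtain ⟨h1, h2⟩ := hvOff j a ha hoff
    rw [hwP, hwM]; dsimp only
    rw [if_neg (show ¬ (1 ≤ a ∧ j + m = jl + a ∧ m < 2 * a) from fun h => hoff h.2.1),
      if_neg (show ¬ (1 ≤ a ∧ j + m = jl + a ∧ m < 2 * a) from fun h => hoff h.2.1), h1, h2]
    exact ⟨rfl, rfl⟩
  have hwLow : ∀ j a, 1 ≤ a → j + m = jl + a → 2 * a ≤ m → wP j a = nP j a ∧ wM j a = nM j a := fun j a ha hdiag hlow => by
    obtain ⟨h1, h2⟩ := hvLow j a ha hdiag hlow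
    rw [hwP, hwM]; dsimp only
    rw [if_neg (show ¬ (1 ≤ a ∧ j + m = jl + a ∧ m < 2 * a) from fun h => by omega),
      if_neg (show ¬ (1 ≤ a ∧ j + m = jl + a ∧ m < 2 * a) from fun h => by omega), h1, h2]
    exact ⟨rfl, rfl⟩
  have hwTopP : ∀ j a, 1 ≤ a → j + m = jl + a → m < 2 * a →
      wP j a = if (d + m ≤ jl ∧ (jl - d - m) % 2 = 0) ∧ 2 * j + d ≤ 2 * jl + 1 then nP j a / (((q : ℚ) - 1) * (q : ℚ) ^ ((2 * a - m + 1) / 2 - 1)) else 0 :=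
    fun j a ha hdiag htop => by
    rw [hwP]; dsimp only
    rw [if_pos ⟨ha, hdiag, htop⟩]
  have hwTopM : ∀ j a, 1 ≤ a → j + m = jl + a → m < 2 * a →
      wM j a = if jl + 1 = d + m ∧ 2 * j + d ≤ 2 * jl + 1 then nM j a / (q : ℚ) ^ ((2 * a - m) / 2) else 0 :=
    fun j a ha hdiag htop => by
    rw [hwM]; dsimp only
    rw [if_pos ⟨ha, hdiag, htop⟩]
  -- the two cut sums agree: the tables differ only on top cells beyond the standard alive boundary, and those are cut
  have hagree : ∀ j a, ¬ (j + m = jl + a ∧ 2 * jl + 1 < 2 * j + d) → vP j a = wP j a ∧ vM j a = wM j a := fun j a hna => by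
    rw [hwP, hwM]; dsimp only
    by_cases hcase : 1 ≤ a ∧ j + m = jl + a ∧ m < 2 * a
    · rw [if_pos hcase, if_pos hcase, hvTopPE j a hcase.1 hcase.2.1 hcase.2.2, hvTopME j a hcase.1 hcase.2.1 hcase.2.2]
      have halive : 2 * j + d ≤ 2 * jl + 1 := by
        by_contra hlt
        exact hna ⟨hcase.2.1, by omega⟩
      have hiffP : ((d + m ≤ jl ∧ (jl - d - m) % 2 = 0) ∧ 2 * j + d ≤ 2 * jl + 1 + e) ↔ ((d + m ≤ jl ∧ (jl - d - m) % 2 = 0) ∧ 2 * j + d ≤ 2 * jl + 1) := by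
        constructor <;> rintro ⟨h1, h2⟩ <;> exact ⟨h1, by omega⟩
      have hiffM : (jl + 1 = d + m ∧ 2 * j + d ≤ 2 * jl + 1 + e) ↔ (jl + 1 = d + m ∧ 2 * j + d ≤ 2 * jl + 1) := by
        constructor <;> rintro ⟨h1, h2⟩ <;> exact ⟨h1, by omega⟩
      rw [if_congr hiffP rfl rfl, if_congr hiffM rfl rfl]
      exact ⟨rfl, rfl⟩
    · rw [if_neg hcase, if_neg hcase]
      exact ⟨rfl, rfl⟩
  rw [cutSum_eq_of_agree_below_alive (q : ℚ) hCe vP vM wP wM hagree]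
  exact toricCensusSum_unr_v5_flip_cutoff q ε hq hd hjl hmS hreal nP nM wP wM hnP hnP0 hnM hw0 hwOff hwLow hwTopP hwTopM C hC

end Summit.HodgeConjecture.HodgeConjecture.Cruxes.H413.F0P3cDyRamToricCensusSumUnrV5FlipCutoff
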